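import Summits.NavierStokesRegularity.NavierStokesRegularity.Theorems.TypeIIInviscidRelaxationAxisymSwirlRegularRadialLaplacianCriterion
import Literature.Analysis.FluidPDE.AxisymNoSwirlImpulseSlice
import Literature.Analysis.FluidPDE.AxisymHouLiVariables
import Literature.Analysis.FluidPDE.LocalHelmholtzSupBound
import Literature.Analysis.FluidPDE.VorticityCalculus
import Literature.Analysis.FluidPDE.AxisymmetricVorticityTransport
import HarnessLib

/-!
# The Biot–Savart criterion in vorticity form: `x_h·Δu_h = ∂_z (r ω_θ)` for axisymmetric divergence-free fields

Helper toward the crux `AxisymSwirlRegular` (stmt-NavierStokesRegularity-1964, route TypeIIInviscidRelaxation),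
criterion side of the registered line `radial_inflow_split` (stub `stub_oneSidedRadialCriterion`, ⟨19059⟩); sequel of
`TypeIIInviscidRelaxationAxisymSwirlRegularRadialLaplacianCriterion`
(`RadialInflowEllipticGate.hasSmoothExtensionPast_of_radialLaplacian_le`: `x₀(Δu)₀ + x₁(Δu)₁ ≤ K r²` near the axis ⇒
continuation).

Here the hypothesis is identified with a statement about the VORTICITY `ω = curl u`: for a `C²` axisymmetric
divergence-free field, `Δu = −curl ω` (tree: `curl_curl_eq_sum_fderiv_divergence_sub_laplacian`) and
`x₀(curl ω)₀ + x₁(curl ω)₁ = Dω₂(x)[Jx] − ∂₂(x₀ω₁ − x₁ω₀) = −∂₂ (swirl ω)(x)` (the first term vanishes by the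
infinitesimal axisymmetry `Dω(x)[Jx] = J ω(x)` of the axisymmetric field `ω`, tree `IsAxisymmetric.curl`,
`IsAxisymmetric.fderiv_rotGen`), where `swirl ω = x₀ω₁ − x₁ω₀ = r ω_θ` is the tree's swirl of the vorticity:

* `radialLaplacian_eq_fderiv_swirl_curl` — `x₀(Δu)₀ + x₁(Δu)₁ = ∂₂ (swirl (curl u)) (x)` (`= ∂_z(r ω_θ) = r ∂_z ω_θ`);
* `hasSmoothExtensionPast_of_fderiv_swirl_curl_le` — **vorticity form of the criterion**: in the standing class of
  the stub, `∂₂ (swirl (curl (u t))) (x) ≤ K · r²` on `{0 < cylRadius x < δ} × [0,T)` for SOME `K`, i.e.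
  `∂_z ω_θ ≤ K r` (`∂_z(ω_θ/r) ≤ K`) near the axis, one-sided, ANY `K` ⇒ `HasSmoothExtensionPast ν 0 u T`;
* `exists_fderiv_swirl_curl_gt_of_not_hasSmoothExtensionPast` — blow-up reading: `sup_{0<r<δ} ∂_z(r ω_θ)/r² = +∞`
  over `[0,T)` for every `δ > 0`.

A CRITERION; nothing here proves `stub_oneSidedRadialCriterion`, `AxisymSwirlRegular` or NavierStokesRegularity. [new]
-/

noncomputable section

set_option linter.dupNamespace false

open Set Filter Topology Real WithLp Metric
open Literature.Analysis.FluidPDE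
open scoped InnerProductSpace RealInnerProductSpace Laplacian ContDiff

namespace Summit.NavierStokesRegularity.NavierStokesRegularity.Theorems.RadialInflowEllipticGate

open Summit.NavierStokesRegularity.NavierStokesRegularity.Theorems

/-- **`x_h·Δu_h = ∂_z(r ω_θ)`** for a `C²` axisymmetric divergence-free field on `ℝ³`:
`x₀(Δu)₀(x) + x₁(Δu)₁(x) = D(swirl (curl u))(x)[e₂]`.  Proof: `Δu = ∇(div u) − curl curl u = −curl ω`;
`x₀(curl ω)₀ + x₁(curl ω)₁ = (Dω(x)[Jx])₂ − (x₀ ∂₂ω₁ − x₁ ∂₂ω₀)`, the first term is `(J ω(x))₂ = 0` by axisymmetry of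
`ω`, the second is `∂₂ (swirl ω)(x)`. [new; folklore kinematics] -/
theorem radialLaplacian_eq_fderiv_swirl_curl {u : EuclideanSpace ℝ (Fin 3) → EuclideanSpace ℝ (Fin 3)}
    (hu : ContDiff ℝ 2 u) (hax : IsAxisymmetric u) (hdiv : VectorCalculus.IsDivFree u)
    (x : EuclideanSpace ℝ (Fin 3)) :
    x 0 * (Δ u) x 0 + x 1 * (Δ u) x 1 = fderiv ℝ (swirl (curl u)) x (EuclideanSpace.single 2 1) := by
  -- `Δu = -curl (curl u)`
  have hcc := curl_curl_eq_sum_fderiv_divergence_sub_laplacian hu x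
  have hdiv0 : VectorCalculus.divergence u = fun _ => (0 : ℝ) := funext hdiv
  have hgrad : ∀ i : Fin 3,
      fderiv ℝ (VectorCalculus.divergence u) x (EuclideanSpace.single i 1) = 0 := fun i => by
    rw [hdiv0]; simp
  simp only [hgrad, zero_smul, Finset.sum_const_zero, zero_sub] at hcc
  have hΔ0 : (Δ u) x 0 = -(curl (curl u) x 0) := by rw [hcc]; simp
  have hΔ1 : (Δ u) x 1 = -(curl (curl u) x 1) := by rw [hcc]; simp
  -- the vorticity is differentiable and axisymmetric
  have hud : Differentiable ℝ u := hu.differentiable (by norm_num)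
  have hωc : ContDiff ℝ 1 (curl u) := contDiff_curl (n := 1) hu
  have hωd : Differentiable ℝ (curl u) := hωc.differentiable one_ne_zero
  have hωax : IsAxisymmetric (curl u) := hax.curl hud
  -- components of `curl ω`
  have h0 := curl_apply_zero_eq_sub (curl u) x
  have h1 := curl_apply_one_eq_sub (curl u) x
  -- infinitesimal axisymmetry of `ω`, third component
  have hJ := hωax.fderiv_rotGen (hωd x)
  have hJ2 : fderiv ℝ (curl u) x (rotGen x) 2 = 0 := by
    rw [hJ]; exact rotGen_apply_two _
  rw [rotGen_eq_sub_single, map_sub, map_smul, map_smul] at hJ2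
  simp only [PiLp.sub_apply, PiLp.smul_apply, smul_eq_mul] at hJ2
  -- the `e₂`-derivative of the swirl of `ω`
  have hsw := fderiv_swirl_apply (hωd x) (EuclideanSpace.single 2 1)
  rw [inner_rotGen_left, rotGen_single_two, inner_zero_left, add_zero] at hsw
  rw [hΔ0, hΔ1, h0, h1, hsw]
  linarith

/-- **Vorticity form of the Biot–Savart criterion.** In the standing class of `stub_oneSidedRadialCriterion`: if for
some `K`, `δ > 0` the vorticity `ω = curl u` satisfies `∂₂ (swirl ω)(t,x) = ∂_z(r ω_θ)(t,x) ≤ K · r²` whenever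
`t ∈ [0,T)`, `0 < cylRadius x < δ` (one-sided: `∂_z ω_θ ≤ K r`, i.e. `∂_z(ω_θ/r) ≤ K`, ANY `K`), then
`HasSmoothExtensionPast ν 0 u T`. (`radialLaplacian_eq_fderiv_swirl_curl` +
`hasSmoothExtensionPast_of_radialLaplacian_le`.) [new] -/
theorem hasSmoothExtensionPast_of_fderiv_swirl_curl_le {ν T K δ : ℝ} (hν : 0 < ν) (hT : 0 < T) (hδ : 0 < δ)
    {u : ℝ → EuclideanSpace ℝ (Fin 3) → EuclideanSpace ℝ (Fin 3)} {p : ℝ → EuclideanSpace ℝ (Fin 3) → ℝ}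
    (hcl : IsClassicalNSSolutionOn (Ico 0 T) ν 0 u p) (hLH : IsLerayHopfOn T ν 0 (u 0) u)
    (hbd : ∀ T' < T, ∃ M : ℝ, ∀ t ∈ Icc 0 T', ∀ x, ‖u t x‖ ≤ M) (hax : ∀ t ∈ Ico 0 T, IsAxisymmetric (u t))
    (hdec : HasRapidSpatialDecay (u 0))
    (hK : ∀ t ∈ Ico 0 T, ∀ x : EuclideanSpace ℝ (Fin 3), 0 < cylRadius x → cylRadius x < δ →
      fderiv ℝ (swirl (curl (u t))) x (EuclideanSpace.single 2 1) ≤ K * cylRadius x ^ 2) :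
    HasSmoothExtensionPast ν 0 u T := by
  refine hasSmoothExtensionPast_of_radialLaplacian_le (K := K) hν hT hδ hcl hLH hbd hax hdec ?_
  intro t ht x hx hxδ
  have hu2 : ContDiff ℝ 2 (u t) := (hcl.contDiff_velocity ht).of_le (by norm_cast)
  rw [radialLaplacian_eq_fderiv_swirl_curl hu2 (hax t ht) (hcl.divFree t ht) x]
  exact hK t ht x hx hxδ

/-- **Blow-up reading in vorticity form.** In the standing class, a solution that does NOT extend smoothly past `T`
has, for every `K` and every `δ > 0`, a time `t ∈ [0,T)` and a point `x` with `0 < cylRadius x < δ` where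
`∂_z(r ω_θ)(t,x) > K · r²` (i.e. `∂_z(ω_θ/r)(t,x) > K`). [new] -/
theorem exists_fderiv_swirl_curl_gt_of_not_hasSmoothExtensionPast {ν T : ℝ} (hν : 0 < ν) (hT : 0 < T)
    {u : ℝ → EuclideanSpace ℝ (Fin 3) → EuclideanSpace ℝ (Fin 3)} {p : ℝ → EuclideanSpace ℝ (Fin 3) → ℝ}
    (hcl : IsClassicalNSSolutionOn (Ico 0 T) ν 0 u p) (hLH : IsLerayHopfOn T ν 0 (u 0) u)
    (hbd : ∀ T' < T, ∃ M : ℝ, ∀ t ∈ Icc 0 T', ∀ x, ‖u t x‖ ≤ M) (hax : ∀ t ∈ Ico 0 T, IsAxisymmetric (u t))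
    (hdec : HasRapidSpatialDecay (u 0)) (hno : ¬ HasSmoothExtensionPast ν 0 u T)
    (K : ℝ) {δ : ℝ} (hδ : 0 < δ) :
    ∃ t ∈ Ico 0 T, ∃ x : EuclideanSpace ℝ (Fin 3), 0 < cylRadius x ∧ cylRadius x < δ ∧
      K * cylRadius x ^ 2 < fderiv ℝ (swirl (curl (u t))) x (EuclideanSpace.single 2 1) := by
  by_contra hcon
  refine hno (hasSmoothExtensionPast_of_fderiv_swirl_curl_le (K := K) hν hT hδ hcl hLH hbd hax hdec ?_)
  intro t ht x hx hxδ
  by_contra hlt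
  exact hcon ⟨t, ht, x, hx, hxδ, lt_of_not_ge hlt⟩

end Summit.NavierStokesRegularity.NavierStokesRegularity.Theorems.RadialInflowEllipticGate

end
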